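import Summits.BirchSwinnertonDyer.BirchSwinnertonDyer.Theorems.SignedLowerHalvesSmallImageLowerHalfBothSignsRttE2NumHeadline
import Mathlib.RingTheory.Flat.Basic
import Mathlib.RingTheory.Finiteness.Finsupp
import HarnessLib

/-!
# Route `SignedLowerHalves`, crux L `SmallImageLowerHalfBothSigns` (stmt-BirchSwinnertonDyer-23599), line `rtt_w3` v13 — E2, LEAD:
# `λ` IS INVARIANT UNDER QUASI-ISOMORPHISMS (finite kernel and cokernel), and finite generation / torsion transfer along them

WHY (BRIEF-E2 rev 3 §3 row `X' ↔ Dψ.X`, `Lines/rtt_w3-BRIEF-E2-g9.md`). The E2 glue `SmallImageRttCharRoad.charRoad_E2_of_parts` (p775611) concludes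
`… ≤ lambdaInvariant p X'` for the third term `X'` of the θ-line four-term sequence and asks `X'` finitely generated torsion over `Λ = ℤ_p⟦T⟧`; the stub's
module is `Dψ.X`, the dual of the saturated transported signed Selmer group over `K^cyc_∞`. The comparison (row D2-seq) is inflation–restriction along
`L_∞ = K(𝔣p^∞) ⊇ K^cyc_∞`, whose error terms `H^{1,2}(Gal(L_∞/K^cyc_∞), (F/𝒪)(θ))` are FINITE, and the map may be `Λ`-antilinear (`γ ↦ γ⁻¹`). This file is
the service algebra for that comparison:
* `subsingleton_baseChange_of_finite`: `ℚ_p ⊗_{ℤ_p} K = 0` for a finite `ℤ_p`-module `K`;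
* ★ `lambdaInvariant_eq_of_finite_ker_coker_semilinear` / `lambdaInvariant_eq_of_finite_ker_coker`: for a `σ`-semilinear (`σ : Λ →+* Λ` fixing the
  constants `C ℤ_p`; e.g. `σ = id` or the involution) map `e : M → N` of `Λ`-modules with FINITE kernel and FINITE cokernel, `λ(M) = λ(N)` — with NO
  finiteness/torsion hypothesis on `M, N` (flatness of `ℚ_p` over `ℤ_p`: `ℚ_p ⊗ e` is bijective);
* `moduleFinite_of_finite_ker`, `isTorsion_of_finite_ker`: along a `Λ`-linear map with finite kernel, finite generation and torsion descend from `N` to `M`.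
THEOREMS ONLY (kernel commutative algebra); nothing about `BirchSwinnertonDyer`, crux L or E2 is proved here. [cite: Washington1997, §13.2] [folklore]
-/

set_option linter.dupNamespace false -- D-0017: single-problem summit, the namespace repeats the problem name by design
set_option autoImplicit false

noncomputable section

open scoped TensorProduct

namespace Summit.BirchSwinnertonDyer.BirchSwinnertonDyer.Theorems.SmallImageRttCharRoad

open Literature.NumberTheory.EllipticCurves

universe u v w

variable {p : ℕ} [Fact p.Prime]

/-- **`ℚ_p ⊗_{ℤ_p} K = 0` for a finite `ℤ_p`-module `K`**: every `x ∈ K` is killed by `n = #K`, a unit of `ℚ_p`. [folklore] -/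
theorem subsingleton_baseChange_of_finite {K : Type w} [AddCommGroup K] [Module ℤ_[p] K] [Finite K] :
    Subsingleton (ℚ_[p] ⊗[ℤ_[p]] K) := by
  refine ⟨fun x y ↦ ?_⟩
  suffices h : ∀ z : ℚ_[p] ⊗[ℤ_[p]] K, z = 0 by rw [h x, h y]
  intro z
  induction z using TensorProduct.induction_on with
  | zero => rfl
  | tmul q k =>
    have hn : (Nat.card K : ℚ_[p]) ≠ 0 := Nat.cast_ne_zero.mpr Nat.card_pos.ne'
    have hk : ((Nat.card K : ℕ) : ℤ_[p]) • k = 0 := by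
      rw [Nat.cast_smul_eq_nsmul]
      exact card_nsmul_eq_zero' (x := k)
    calc q ⊗ₜ[ℤ_[p]] k = (((Nat.card K : ℕ) : ℤ_[p]) • (q * (Nat.card K : ℚ_[p])⁻¹)) ⊗ₜ[ℤ_[p]] k := by
          congr 1
          rw [Algebra.smul_def, map_natCast, mul_comm, inv_mul_cancel_right₀ hn]
      _ = 0 := by rw [TensorProduct.smul_tmul, hk, TensorProduct.tmul_zero]
  | add a b ha hb => rw [ha, hb, add_zero]

/-- **`λ` is invariant under quasi-isomorphisms (semilinear form).** Let `σ : Λ → Λ` be a ring map fixing the constants `C ℤ_p` (surjective, e.g.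
`σ = id` or the involution `γ ↦ γ⁻¹`), and `e : M →ₛₗ[σ] N` a `σ`-semilinear map of `Λ`-modules with finite kernel and finite cokernel. Then
`λ(M) = λ(N)`: `e` is `ℤ_p`-linear, and after `ℚ_p ⊗_{ℤ_p} (·)` (exact, `ℚ_p` flat) its kernel and cokernel vanish, so `ℚ_p ⊗ M ≅ ℚ_p ⊗ N`. No finiteness or
torsion hypothesis on `M`, `N`. [cite: Washington1997, §13.2] [folklore] -/
theorem lambdaInvariant_eq_of_finite_ker_coker_semilinear {M : Type u} {N : Type v} [AddCommGroup M] [Module (IwasawaAlgebra p) M]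
    [AddCommGroup N] [Module (IwasawaAlgebra p) N] {σ : IwasawaAlgebra p →+* IwasawaAlgebra p} [RingHomSurjective σ]
    (hσ : ∀ c : ℤ_[p], σ (PowerSeries.C c) = PowerSeries.C c) (e : M →ₛₗ[σ] N)
    (hker : Finite (LinearMap.ker e)) (hcoker : Finite (N ⧸ LinearMap.range e)) :
    lambdaInvariant p M = lambdaInvariant p N := by
  -- the `ℤ_p`-structures by restriction along the constants
  letI iM : Module ℤ_[p] M := Module.compHom M (algebraMap ℤ_[p] (IwasawaAlgebra p))
  letI iN : Module ℤ_[p] N := Module.compHom N (algebraMap ℤ_[p] (IwasawaAlgebra p))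
  have hCM : ∀ (r : ℤ_[p]) (m : M), (PowerSeries.C r : IwasawaAlgebra p) • m = r • m := fun r m ↦ by
    change (PowerSeries.C r : IwasawaAlgebra p) • m = (algebraMap ℤ_[p] (IwasawaAlgebra p) r) • m
    rw [PowerSeries.algebraMap_apply, Algebra.algebraMap_self_apply]
  have hCN : ∀ (r : ℤ_[p]) (n : N), (PowerSeries.C r : IwasawaAlgebra p) • n = r • n := fun r n ↦ by
    change (PowerSeries.C r : IwasawaAlgebra p) • n = (algebraMap ℤ_[p] (IwasawaAlgebra p) r) • n
    rw [PowerSeries.algebraMap_apply, Algebra.algebraMap_self_apply]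
  rw [Summit.BirchSwinnertonDyer.BirchSwinnertonDyer.Theorems.SmallImageRttE2Num.lambdaInvariant_eq_finrank_baseChange_of_C_smul M hCM,
    Summit.BirchSwinnertonDyer.BirchSwinnertonDyer.Theorems.SmallImageRttE2Num.lambdaInvariant_eq_finrank_baseChange_of_C_smul N hCN]
  -- `e` as a `ℤ_p`-linear map
  let eZ : M →ₗ[ℤ_[p]] N :=
    { e.toAddMonoidHom with
      map_smul' := fun c x ↦ by
        change e ((PowerSeries.C c : IwasawaAlgebra p) • x) = _
        rw [e.map_smulₛₗ, hσ, hCN]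
        rfl }
  have heZ : ∀ x, eZ x = e x := fun _ ↦ rfl
  -- finite kernel and cokernel of `eZ`
  haveI : Finite (LinearMap.ker eZ) :=
    Finite.of_injective (fun x : LinearMap.ker eZ ↦ (⟨x.1, x.2⟩ : LinearMap.ker e))
      fun a b h ↦ Subtype.ext (congrArg Subtype.val h)
  have hrange : (LinearMap.range e).toAddSubgroup = (LinearMap.range eZ).toAddSubgroup := by
    ext x
    simp only [Submodule.mem_toAddSubgroup, LinearMap.mem_range, heZ]
  haveI : Finite (N ⧸ LinearMap.range eZ) :=
    Finite.of_equiv (N ⧸ LinearMap.range e) (QuotientAddGroup.quotientAddEquivOfEq hrange).toEquiv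
  haveI : Module.Flat ℤ_[p] ℚ_[p] := IsLocalization.flat ℚ_[p] (nonZeroDivisors ℤ_[p])
  -- `ℚ_p ⊗ eZ` is injective and surjective
  have h1 := Module.Flat.lTensor_exact ℚ_[p] (LinearMap.exact_subtype_ker_map eZ)
  have h2 := Module.Flat.lTensor_exact ℚ_[p] (LinearMap.exact_map_mkQ_range eZ)
  haveI hK0 : Subsingleton (ℚ_[p] ⊗[ℤ_[p]] LinearMap.ker eZ) := subsingleton_baseChange_of_finite
  haveI hC0 : Subsingleton (ℚ_[p] ⊗[ℤ_[p]] (N ⧸ LinearMap.range eZ)) := subsingleton_baseChange_of_finite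
  have hinj : Function.Injective (eZ.lTensor ℚ_[p]) := by
    rw [← LinearMap.ker_eq_bot, h1.linearMap_ker_eq, LinearMap.range_eq_bot]
    exact Subsingleton.elim _ _
  have hsurj : Function.Surjective (eZ.lTensor ℚ_[p]) := by
    rw [← LinearMap.range_eq_top, ← h2.linearMap_ker_eq, LinearMap.ker_eq_top]
    exact Subsingleton.elim _ _
  have hbij : Function.Bijective (eZ.baseChange ℚ_[p]) := by
    rw [Function.Bijective, show (eZ.baseChange ℚ_[p] : ℚ_[p] ⊗[ℤ_[p]] M → ℚ_[p] ⊗[ℤ_[p]] N) = eZ.lTensor ℚ_[p] from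
      LinearMap.baseChange_eq_ltensor eZ]
    exact ⟨hinj, hsurj⟩
  exact (LinearEquiv.ofBijective (eZ.baseChange ℚ_[p]) hbij).finrank_eq

/-- **`λ` is invariant under quasi-isomorphisms**: a `Λ`-linear map with finite kernel and finite cokernel preserves `λ` (no finiteness or torsion
hypothesis on the modules). [cite: Washington1997, §13.2] [folklore] -/
theorem lambdaInvariant_eq_of_finite_ker_coker {M : Type u} {N : Type v} [AddCommGroup M] [Module (IwasawaAlgebra p) M]
    [AddCommGroup N] [Module (IwasawaAlgebra p) N] (e : M →ₗ[IwasawaAlgebra p] N)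
    (hker : Finite (LinearMap.ker e)) (hcoker : Finite (N ⧸ LinearMap.range e)) :
    lambdaInvariant p M = lambdaInvariant p N :=
  lambdaInvariant_eq_of_finite_ker_coker_semilinear (fun _ ↦ rfl) e hker hcoker

/-- **Finite generation descends along a map with finite kernel**: if `N` is finitely generated over `Λ` and `e : M → N` is `Λ`-linear with finite
kernel, then `M` is finitely generated (`Λ` is Noetherian: the image is finitely generated, and so is the finite kernel). [folklore] -/
theorem moduleFinite_of_finite_ker {M : Type u} {N : Type v} [AddCommGroup M] [Module (IwasawaAlgebra p) M]
    [AddCommGroup N] [Module (IwasawaAlgebra p) N] [Module.Finite (IwasawaAlgebra p) N] (e : M →ₗ[IwasawaAlgebra p] N)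
    (hker : Finite (LinearMap.ker e)) : Module.Finite (IwasawaAlgebra p) M := by
  haveI : IsNoetherian (IwasawaAlgebra p) N := isNoetherian_of_isNoetherianRing_of_finite _ _
  refine ⟨Submodule.fg_of_fg_map_of_fg_inf_ker e ?_ ?_⟩
  · exact IsNoetherian.noetherian _
  · rw [top_inf_eq]
    exact Module.Finite.iff_fg.mp (Module.Finite.of_finite (R := IwasawaAlgebra p) (M := LinearMap.ker e))

/-- **Torsion descends along a map with finite kernel**: if `N` is a torsion `Λ`-module and `e : M → N` is `Λ`-linear with finite kernel, then `M`
is torsion (`a•x ∈ ker e` for some non-zero-divisor `a`, and the finite kernel is killed by a power of `p`). [folklore] -/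
theorem isTorsion_of_finite_ker {M : Type u} {N : Type v} [AddCommGroup M] [Module (IwasawaAlgebra p) M]
    [AddCommGroup N] [Module (IwasawaAlgebra p) N] (e : M →ₗ[IwasawaAlgebra p] N) (hN : Module.IsTorsion (IwasawaAlgebra p) N)
    (hker : Finite (LinearMap.ker e)) : Module.IsTorsion (IwasawaAlgebra p) M := by
  intro x
  obtain ⟨⟨a, ha⟩, hax⟩ := @hN (e x)
  -- `a • x ∈ ker e`, a finite group: killed by its cardinality `n`
  have hmem : a • x ∈ LinearMap.ker e := by
    rw [LinearMap.mem_ker, map_smul]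
    exact hax
  set n : ℕ := Nat.card (LinearMap.ker e) with hn
  have hn0 : n ≠ 0 := Nat.card_pos.ne'
  have hkill : (PowerSeries.C (n : ℤ_[p]) : IwasawaAlgebra p) • (a • x) = 0 := by
    have h := card_nsmul_eq_zero' (x := (⟨a • x, hmem⟩ : LinearMap.ker e))
    rw [← hn] at h
    have h' : n • (a • x) = 0 := by simpa using congrArg Subtype.val h
    rw [map_natCast, Nat.cast_smul_eq_nsmul, h']
  refine ⟨⟨PowerSeries.C (n : ℤ_[p]) * a, mul_mem (mem_nonZeroDivisors_of_ne_zero ?_) ha⟩, ?_⟩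
  · intro h
    apply hn0
    have h0 := congrArg (PowerSeries.constantCoeff (R := ℤ_[p])) h
    rw [PowerSeries.constantCoeff_C, map_zero] at h0
    exact_mod_cast h0
  · rw [Submonoid.smul_def, mul_smul]
    exact hkill

/-! ## Appendix (LEAD g9, same day): the `σ`-semilinear transfers (for a `Λ`-ANTIlinear comparison `X' → Dψ.X`) -/

/-- **Finite generation descends along a `σ`-semilinear map with finite kernel** (`σ : Λ → Λ` surjective, e.g. the involution): if `N` is
finitely generated over `Λ` and `e : M →ₛₗ[σ] N` has finite kernel then `M` is finitely generated — preimages of generators of the image (a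
`Λ`-submodule of the Noetherian `N`) together with the finite kernel generate `M`. [folklore] -/
theorem moduleFinite_of_finite_ker_semilinear {M : Type u} {N : Type v} [AddCommGroup M] [Module (IwasawaAlgebra p) M]
    [AddCommGroup N] [Module (IwasawaAlgebra p) N] {σ : IwasawaAlgebra p →+* IwasawaAlgebra p} [RingHomSurjective σ]
    [Module.Finite (IwasawaAlgebra p) N] (e : M →ₛₗ[σ] N) (hker : Finite (LinearMap.ker e)) :
    Module.Finite (IwasawaAlgebra p) M := by
  classical
  haveI : IsNoetherian (IwasawaAlgebra p) N := isNoetherian_of_isNoetherianRing_of_finite _ _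
  -- generators of the image and preimages
  obtain ⟨T, hT⟩ : (LinearMap.range e).FG := IsNoetherian.noetherian _
  have hpre : ∀ t : T, ∃ m : M, e m = (t : N) := fun t ↦ by
    have ht : (t : N) ∈ LinearMap.range e := hT ▸ Submodule.subset_span t.2
    exact LinearMap.mem_range.mp ht
  choose m hm using hpre
  -- the finite kernel is finitely generated
  have hK : (LinearMap.ker e).FG := Module.Finite.iff_fg.mp (Module.Finite.of_finite (R := IwasawaAlgebra p) (M := LinearMap.ker e))
  refine ⟨Submodule.fg_def.mpr ?_⟩
  obtain ⟨SK, hSKfin, hSK⟩ := Submodule.fg_def.mp hK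
  refine ⟨Set.range m ∪ SK, (Set.finite_range m).union hSKfin, ?_⟩
  rw [eq_top_iff]
  rintro x -
  -- write `e x` on the generators, lift the coefficients along `σ`
  have hx : e x ∈ Submodule.span (IwasawaAlgebra p) (T : Set N) := hT ▸ LinearMap.mem_range_self e x
  obtain ⟨c, hc⟩ := (Finsupp.mem_span_iff_linearCombination _ _ _).mp hx
  -- `c : T →₀ Λ` with `Σ c t • t = e x`; choose `s t` with `σ (s t) = c t`
  have hsurjσ : Function.Surjective σ := RingHomSurjective.is_surjective
  choose s hs using fun t : T ↦ hsurjσ (c t)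
  set y : M := ∑ t ∈ c.support, s t • m t with hy
  have hey : e y = e x := by
    rw [hy, map_sum, ← hc, Finsupp.linearCombination_apply, Finsupp.sum]
    refine Finset.sum_congr rfl fun t _ ↦ ?_
    rw [LinearMap.map_smulₛₗ, hs, hm]
  have hker' : x - y ∈ LinearMap.ker e := by rw [LinearMap.mem_ker, map_sub, hey, sub_self]
  have hy_mem : y ∈ Submodule.span (IwasawaAlgebra p) (Set.range m ∪ SK) := by
    rw [hy]
    exact Submodule.sum_mem _ fun t _ ↦ Submodule.smul_mem _ _ (Submodule.subset_span (Or.inl ⟨t, rfl⟩))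
  have hk_mem : x - y ∈ Submodule.span (IwasawaAlgebra p) (Set.range m ∪ SK) := by
    refine Submodule.span_mono Set.subset_union_right ?_
    rw [hSK]
    exact hker'
  have : x = (x - y) + y := by abel
  rw [this]
  exact Submodule.add_mem _ hk_mem hy_mem

/-- **Torsion descends along a `σ`-semilinear map with finite kernel** (`σ : Λ → Λ` surjective): if `N` is a torsion `Λ`-module and
`e : M →ₛₗ[σ] N` has finite kernel then `M` is torsion. [folklore] -/
theorem isTorsion_of_finite_ker_semilinear {M : Type u} {N : Type v} [AddCommGroup M] [Module (IwasawaAlgebra p) M]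
    [AddCommGroup N] [Module (IwasawaAlgebra p) N] {σ : IwasawaAlgebra p →+* IwasawaAlgebra p} [RingHomSurjective σ]
    (e : M →ₛₗ[σ] N) (hN : Module.IsTorsion (IwasawaAlgebra p) N) (hker : Finite (LinearMap.ker e)) :
    Module.IsTorsion (IwasawaAlgebra p) M := by
  intro x
  obtain ⟨⟨a, ha⟩, hax⟩ := @hN (e x)
  obtain ⟨s, hs⟩ := (RingHomSurjective.is_surjective : Function.Surjective σ) a
  have hs0 : s ≠ 0 := by
    rintro rfl
    rw [map_zero] at hs
    exact nonZeroDivisors.ne_zero ha hs.symm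
  have hmem : s • x ∈ LinearMap.ker e := by
    rw [LinearMap.mem_ker, LinearMap.map_smulₛₗ, hs]
    exact hax
  set n : ℕ := Nat.card (LinearMap.ker e) with hn
  have hn0 : n ≠ 0 := Nat.card_pos.ne'
  have hkill : (PowerSeries.C (n : ℤ_[p]) : IwasawaAlgebra p) • (s • x) = 0 := by
    have h := card_nsmul_eq_zero' (x := (⟨s • x, hmem⟩ : LinearMap.ker e))
    rw [← hn] at h
    have h' : n • (s • x) = 0 := by simpa using congrArg Subtype.val h
    rw [map_natCast, Nat.cast_smul_eq_nsmul, h']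
  refine ⟨⟨PowerSeries.C (n : ℤ_[p]) * s, mul_mem (mem_nonZeroDivisors_of_ne_zero ?_) (mem_nonZeroDivisors_of_ne_zero hs0)⟩, ?_⟩
  · intro h
    apply hn0
    have h0 := congrArg (PowerSeries.constantCoeff (R := ℤ_[p])) h
    rw [PowerSeries.constantCoeff_C, map_zero] at h0
    exact_mod_cast h0
  · rw [Submonoid.smul_def, mul_smul]
    exact hkill

/-- **Finite generation ascends along a `σ`-semilinear map with finite cokernel** (`σ` surjective): if `N` is finitely generated and
`e : N →ₛₗ[σ] M` has finite cokernel `M ⧸ e(N)`, then `M` is finitely generated (the image is finitely generated, and so is the finite quotient).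
[folklore] -/
theorem moduleFinite_of_finite_coker_semilinear {M : Type u} {N : Type v} [AddCommGroup M] [Module (IwasawaAlgebra p) M]
    [AddCommGroup N] [Module (IwasawaAlgebra p) N] {σ : IwasawaAlgebra p →+* IwasawaAlgebra p} [RingHomSurjective σ]
    [Module.Finite (IwasawaAlgebra p) N] (e : N →ₛₗ[σ] M) (hcoker : Finite (M ⧸ LinearMap.range e)) :
    Module.Finite (IwasawaAlgebra p) M := by
  classical
  -- the image is finitely generated: images of generators generate (σ surjective)
  have hrange : (LinearMap.range e).FG := by
    obtain ⟨T, hT⟩ := Module.Finite.fg_top (R := IwasawaAlgebra p) (M := N)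
    refine ⟨T.image e, ?_⟩
    apply le_antisymm
    · rw [Submodule.span_le]
      intro m hm
      obtain ⟨t, -, rfl⟩ := Finset.mem_image.mp (Finset.mem_coe.mp hm)
      exact LinearMap.mem_range_self e t
    · rintro _ ⟨n, rfl⟩
      have hn : n ∈ Submodule.span (IwasawaAlgebra p) (T : Set N) := by rw [hT]; trivial
      refine Submodule.span_induction (p := fun n _ ↦ e n ∈ Submodule.span (IwasawaAlgebra p) (T.image e : Set M)) ?_ ?_ ?_ ?_ hn
      · intro t ht
        exact Submodule.subset_span (Finset.mem_coe.mpr (Finset.mem_image_of_mem e (Finset.mem_coe.mp ht)))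
      · rw [map_zero]; exact Submodule.zero_mem _
      · intro a b _ _ ha hb
        rw [map_add]; exact Submodule.add_mem _ ha hb
      · intro r a _ ha
        rw [LinearMap.map_smulₛₗ]; exact Submodule.smul_mem _ _ ha
  refine ⟨Submodule.fg_of_fg_map_of_fg_inf_ker (LinearMap.range e).mkQ ?_ ?_⟩
  · rw [Submodule.map_top, Submodule.range_mkQ]
    exact Module.finite_def.mp (Module.Finite.of_finite (R := IwasawaAlgebra p) (M := M ⧸ LinearMap.range e))
  · rw [top_inf_eq, Submodule.ker_mkQ]
    exact hrange

/-- **Torsion ascends along a `σ`-semilinear map with finite cokernel** (`σ` surjective AND injective, e.g. `id` or the involution): if `N` is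
torsion and `e : N →ₛₗ[σ] M` has finite cokernel, then `M` is torsion (`n • x ∈ e(N)` for `n = #(M ⧸ e(N))`, and images of torsion elements are
torsion). [folklore] -/
theorem isTorsion_of_finite_coker_semilinear {M : Type u} {N : Type v} [AddCommGroup M] [Module (IwasawaAlgebra p) M]
    [AddCommGroup N] [Module (IwasawaAlgebra p) N] {σ : IwasawaAlgebra p →+* IwasawaAlgebra p} [RingHomSurjective σ]
    (hσinj : Function.Injective σ)
    (e : N →ₛₗ[σ] M) (hN : Module.IsTorsion (IwasawaAlgebra p) N) (hcoker : Finite (M ⧸ LinearMap.range e)) :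
    Module.IsTorsion (IwasawaAlgebra p) M := by
  intro x
  set n : ℕ := Nat.card (M ⧸ LinearMap.range e) with hn
  have hn0 : n ≠ 0 := Nat.card_pos.ne'
  -- `n • x ∈ range e`
  have hmem : (PowerSeries.C (n : ℤ_[p]) : IwasawaAlgebra p) • x ∈ LinearMap.range e := by
    have h := card_nsmul_eq_zero' (x := (LinearMap.range e).mkQ x)
    rw [← hn, ← map_nsmul, Submodule.mkQ_apply, Submodule.Quotient.mk_eq_zero] at h
    rwa [map_natCast, Nat.cast_smul_eq_nsmul]
  obtain ⟨y, hy⟩ := LinearMap.mem_range.mp hmem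
  obtain ⟨⟨a, ha⟩, hay⟩ := @hN y
  have hσa0 : σ a ≠ 0 := fun h ↦ nonZeroDivisors.ne_zero ha (hσinj (by rw [h, map_zero]))
  refine ⟨⟨σ a * PowerSeries.C (n : ℤ_[p]), mul_mem (mem_nonZeroDivisors_of_ne_zero hσa0) (mem_nonZeroDivisors_of_ne_zero ?_)⟩, ?_⟩
  · intro h
    apply hn0
    have h0 := congrArg (PowerSeries.constantCoeff (R := ℤ_[p])) h
    rw [PowerSeries.constantCoeff_C, map_zero] at h0
    exact_mod_cast h0
  · have hay' : a • y = 0 := hay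
    rw [Submonoid.smul_def, mul_smul, ← hy, ← LinearMap.map_smulₛₗ, hay', map_zero]

end Summit.BirchSwinnertonDyer.BirchSwinnertonDyer.Theorems.SmallImageRttCharRoad

end
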